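import Literature.IUT.HodgeArakelov.TwoSectionsNonVacuity
import Literature.IUT.HodgeArakelov.TwoSectionsRigidityConvention
import HarnessLib

/-!
# [IUTchII] Rmk. 1.1.1 (iii) AT THE GENUINE FRAME: the two sections AND THE COMMUTATOR MAP pinned — (P1)/(P2)/(P3)

Mochizuki, *Inter-universal Teichmüller theory II*, §1, Remark 1.1.1 (iii), kurims manuscript (Dec. 2020) pp. 22–23
[claim: Mochizuki2012, status: disputed] (IUTchII §1 Rmk 1.1.1 (iii), kurims pp.22-23): «forming the commutator
`γ(β)·β⁻¹` of such liftings with arbitrary `β ∈ Δ_Y(M^Θ)`, one obtains a natural bilinear commutator map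
`[-,-] : (Δ_X(M^Θ)/Δ_Y(M^Θ)) × Δ^ell_Y(M^Θ) → Π_{M^Θ}|_{(l·Δ_Θ)(M^Θ)}`»; [EtTh] Cor. 2.19 (i), Prop. 2.12 (i)
[cite: MochizukiEtTh2009, Cor 2.19(i) p.64]. abc-iut cell, layer L6, seat abc-iut-w4-d035 (gen 11), GAP-LEDGER row
**G-w4d018-1** (commutator-equivariance sub-clause of Rmk. 1.1.1 (iv); its missing lemma (iii) «a re-run of p437698's
`TwoSections` construction exporting the commutator pin (P3)»), node **IUTchII:Rmk1.1.1(iv)** (iv)-C. PROOF-ONLY.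
`ModelFrame.exists_twoSections_pinned_of_coreTower` = abc-iut-w4-d043's `exists_twoSections_rigidity_of_coreTower`
(p448420; abc-iut-w5-d225's GENUINE construction p437698 with the sections pinned) REPEATED VERBATIM — an `∃`-statement
does not expose its witness (precedent: p448420, p442142) — with ONE conjunct added, the COMMUTATOR PIN (P3): for
`x ∈ Π^tp_{X̲̲}` with `aug x = 1` and `b ∈ Δ_Y(M) = Δ^tp_{Y̲̲}`, `Sec.commutator [x] [b]` is the class of
`e⁻¹(s^alg(x b x⁻¹ b⁻¹))` (`x b x⁻¹ b⁻¹` lies in the `(l·Δ_Θ)`-preimage by Heisenberg surjectivity, [EtTh] Prop. 2.12 (i);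
independence of the lifts = p437698's (T1)/(T2)). Kept from p448420: the `T` pin, `C′.iso = (B8 iso)⁻¹`,
`rigidity_is_difference Sec C′`, (P1), (P2). No `Prop` fact introduced, no FACT-LIST row consumed; binders = p448420's.
HONEST FRAMING: kernel facts about the cell's own interfaces and model; Rmk. 1.1.1 lies outside the [IUTchIII]
Cor. 3.12 cone; no side taken on Cor. 3.12; typed ≠ proved; constructed ≠ endorsed.
-/

noncomputable section

namespace Literature.IUT.HodgeArakelov

open Literature.AnabelianGeometry.EtaleTheta Literature.AnabelianGeometry.SemiGraphs
open scoped Literature.AnabelianGeometry.EtaleTheta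

namespace ModelFrame

variable {p : ℕ} [Fact p.Prime] {Mt : MuTwoSetting p}
  {E : Mt.toThetaSetting.EtaleThetaData} {l : ℕ} (C : E.DoubleUnderline l)
  {S : ThetaSetting.{0}} (μ : Mt.toThetaSetting.CyclotomeMod l S.N)
  (hC : Mt.toThetaSetting.Compat) (hS : Mt.toThetaSetting.Sec2Hyps)
  (h15 : ThetaSetting.Prop15iii E hC) (L : C.CuspLabels)
  (F : ModelFrame S (C.rigidData μ hC hS h15 L)) {Menv : MonoThetaEnv S}
  (e : Menv.Pi ≃ₜ* (C.rigidData μ hC hS h15 L).env)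

set_option maxHeartbeats 400000 in
/-- **IUTchII:Rmk1.1.1(iii) at the GENUINE frame — pinned two sections, PINNED COMMUTATOR MAP, and the
difference-convention Def. 1.1 (ii) datum `C′` with `rigidity_is_difference Sec C′`.** Binders = abc-iut-w5-d225's
`exists_twoSections_of_coreTower` (p437698) with the theta cocycle `η` explicit; the construction of `T`, `Sec`, `C′` is
p448420's verbatim. Conjuncts: the `T` pin; `C′.iso = (B8 iso)⁻¹` pointwise in `Π_M`; `rigidity_is_difference Sec C′`;
(P1) the class of `e⁻¹(s^Θ_η g)` lies in `Sec.sTheta`; (P2) every element of `Sec.sAlg` is the class of some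
`e⁻¹(s^alg g)`; **(P3)** `Sec.commutator [x] [b]` is the class of `e⁻¹(s^alg(x b x⁻¹ b⁻¹))` for every
`Δ_{X̲̲}`-element `x` (`aug x = 1`) and every `b ∈ Δ_Y(M)`.
[claim: Mochizuki2012, status: disputed] (IUTchII §1 Rmk 1.1.1 (iii), kurims pp.22-23) -/
theorem exists_twoSections_pinned_of_coreTower (hO : Mt.toThetaSetting.IsEtThOrigin)
    (hYcl : (Mt.DtpY.map Mt.toHat.toMonoidHom).topologicalClosure ≤
      Mt.DtpY.map Mt.toHat.toMonoidHom ⊔ (⁅⁅Mt.DeltaHat, Mt.DeltaHat⁆, Mt.DeltaHat⁆).topologicalClosure)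
    {η : (C.rigidData μ hC hS h15 L).PiYdd → (C.rigidData μ hC hS h15 L).mu}
    (hη : η ∈ (C.rigidData μ hC hS h15 L).thetaCocycles)
    (W : CoreTower (F.reconstruction e))
    (hWker : W.kerEll = ((Mt.thetaToEll.comp Mt.toTheta).ker).comap
      (C.Huu.subtype.comp (Mt.GtpY.subgroupOf C.Huu).subtype)) :
    ∃ (T : ThetaQuotientData (F.reconstruction e)) (Sec : TwoSections T W)
      (C' : CyclotomicRigidity (F.reconstruction e)),
      T.thetaSection = (((C.rigidData μ hC hS h15 L).thetaKer.subgroupOf (C.rigidData μ hC hS h15 L).PiY).map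
          (CycEnvelope.algSection (C.rigidData μ hC hS h15 L).augY (C.rigidData μ hC hS h15 L).chi)).comap
          e.toMulEquiv.toMonoidHom ∧
      (∀ c, ((C'.iso c : ↥(F.reconstruction e).extCyc) : Menv.Pi) =
        (((F.cyclotomicRigidity e).iso c : ↥(F.reconstruction e).extCyc) : Menv.Pi)⁻¹) ∧
      rigidity_is_difference Sec C' ∧
      (∀ g : ↥(C.rigidData μ hC hS h15 L).lDeltaTheta,
        ∃ hg : e.symm ((C.rigidData μ hC hS h15 L).toThetaEnvData.sTheta hη
            ⟨(g : (C.rigidData μ hC hS h15 L).PiX),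
              (Subgroup.mem_inf.1 ((C.rigidData μ hC hS h15 L).lDeltaTheta_le g.2)).1⟩) ∈ T.envAtTheta.top,
          (QuotientGroup.mk (⟨_, hg⟩ : ↥T.envAtTheta.top) : T.envAtTheta.carrier) ∈ Sec.sTheta) ∧
      (∀ s ∈ Sec.sAlg, ∃ (g : ↥(C.rigidData μ hC hS h15 L).lDeltaTheta)
        (hg : e.symm ((C.rigidData μ hC hS h15 L).toThetaEnvData.sAlg
            ⟨(g : (C.rigidData μ hC hS h15 L).PiX),
              (Subgroup.mem_inf.1 ((C.rigidData μ hC hS h15 L).lDeltaTheta_le g.2)).1⟩) ∈ T.envAtTheta.top),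
          s = (QuotientGroup.mk (⟨_, hg⟩ : ↥T.envAtTheta.top) : T.envAtTheta.carrier)) ∧
      (∀ (x : ↥C.Huu) (_hx : Mt.aug (x : Mt.PiTemp) = 1) (b : ↥(F.reconstruction e).DeltaY),
        ∃ (hmem : x * ((b : ↥(Mt.GtpY.subgroupOf C.Huu)) : ↥C.Huu) * x⁻¹ *
              (((b : ↥(Mt.GtpY.subgroupOf C.Huu)) : ↥C.Huu))⁻¹ ∈ (C.rigidData μ hC hS h15 L).lDeltaTheta)
          (hg : e.symm ((C.rigidData μ hC hS h15 L).toThetaEnvData.sAlg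
            ⟨((⟨_, hmem⟩ : ↥(C.rigidData μ hC hS h15 L).lDeltaTheta) : (C.rigidData μ hC hS h15 L).PiX),
              (Subgroup.mem_inf.1 ((C.rigidData μ hC hS h15 L).lDeltaTheta_le hmem)).1⟩) ∈ T.envAtTheta.top),
          Sec.commutator (QuotientGroup.mk x : ↥C.Huu ⧸ (F.reconstruction e).inclY.range)
              (QuotientGroup.mk b : W.DeltaYell) =
            (QuotientGroup.mk (⟨_, hg⟩ : ↥T.envAtTheta.top) : T.envAtTheta.carrier)) := by
  classical
  set R : RigidData S.N l := C.rigidData μ hC hS h15 L with hRdef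
  obtain ⟨T, hTker, hTsec, hText⟩ := ModelFrame.exists_thetaQuotientData_model F e
  haveI hinclYn : (F.reconstruction e).inclY.range.Normal := (F.reconstruction e).inclY_normal
  haveI hkerElln : W.kerEll.Normal := W.kerEll_normal
  haveI hdeltaElln : (W.kerEll.subgroupOf (F.reconstruction e).DeltaY).Normal := W.deltaEll_normal
  have haugR : ∀ x : ↥C.Huu, x ∈ R.aug.ker ↔ Mt.aug (x : Mt.PiTemp) = 1 := fun x => by
    rw [MonoidHom.mem_ker, ← OneMemClass.coe_eq_one]; rfl
  have hlDT_PiY : R.lDeltaTheta ≤ R.PiY := fun t ht => R.PiYdd_le (R.lDeltaTheta_le ht).1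
  have hlDT_PiYdd : R.lDeltaTheta ≤ R.PiYdd := fun t ht => (R.lDeltaTheta_le ht).1
  have hmemL : ∀ t : ↥C.Huu, t ∈ R.lDeltaTheta ↔ Mt.toTheta (t : Mt.PiTemp) ∈ Mt.lDeltaTheta l := fun _ => Iff.rfl
  have hmemK : ∀ t : ↥C.Huu, t ∈ R.thetaKer ↔ Mt.toTheta (t : Mt.PiTemp) = 1 := fun _ => Iff.rfl
  have hcomm := C.rigidData_hcomm_of_origin μ hC hS h15 L hO hYcl
  have hΔY : ∀ y : ↥(F.reconstruction e).DeltaY,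
      Mt.aug (((y : ↥(Mt.GtpY.subgroupOf C.Huu)) : ↥C.Huu) : Mt.PiTemp) = 1 := fun y =>
    (mem_deltaY_reconstruction_iff C μ hC hS h15 L F e y.1).1 y.2
  have hcent : ∀ c ∈ Mt.DeltaTheta, ∀ g ∈ (Mt.aug.toMonoidHom.ker).map Mt.toTheta, c * g = g * c :=
    fun c hc g hg => Mt.ker_thetaToEll_central c hc g hg
  have hcommΘ : ∀ c₁ ∈ Mt.DeltaTheta, ∀ c₂ ∈ Mt.DeltaTheta, c₁ * c₂ = c₂ * c₁ :=
    fun c₁ h₁ c₂ h₂ => Mt.ker_thetaToEll_comm c₁ h₁ c₂ h₂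
  have hYab : ∀ h₁ ∈ Mt.DtpYTheta, ∀ h₂ ∈ Mt.DtpYTheta, h₁ * h₂ = h₂ * h₁ := Mt.toThetaSetting.dtpYTheta_comm hO
  have hθΔ : ∀ x : ↥C.Huu, Mt.aug (x : Mt.PiTemp) = 1 →
      Mt.toTheta (x : Mt.PiTemp) ∈ (Mt.aug.toMonoidHom.ker).map Mt.toTheta := fun x hx =>
    Subgroup.mem_map_of_mem _ (by exact hx)
  have hθY : ∀ b : ↥(Mt.GtpY.subgroupOf C.Huu), Mt.aug ((b : ↥C.Huu) : Mt.PiTemp) = 1 →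
      Mt.toTheta ((b : ↥C.Huu) : Mt.PiTemp) ∈ Mt.DtpYTheta := fun b hb =>
    Subgroup.mem_map_of_mem _ ⟨Subgroup.mem_subgroupOf.1 b.2, hb⟩
  have hYΔ : Mt.DtpYTheta ≤ (Mt.aug.toMonoidHom.ker).map Mt.toTheta := Subgroup.map_mono inf_le_right
  have htop : ∀ m : Menv.Pi, m ∈ T.envAtTheta.top ↔
      (((F.reconstruction e).projY m : ↥R.PiY) : ↥C.Huu) ∈ R.lDeltaTheta := fun m => Iff.rfl
  have hbot : ∀ m : Menv.Pi, m ∈ T.envAtTheta.bot ↔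
      e m ∈ ((R.thetaKer.subgroupOf R.PiY).map (CycEnvelope.algSection R.augY R.chi)) := fun m => by
    change m ∈ T.thetaSection ↔ _; rw [hTsec]; rfl
  have hprojY : ∀ m : Menv.Pi, (F.reconstruction e).projY m = (e m).right := fun m => rfl
  let ι₁ : ↥R.lDeltaTheta →* ↥R.PiY := Subgroup.inclusion hlDT_PiY
  let f₀ : ↥R.lDeltaTheta →* Menv.Pi :=
    e.symm.toMulEquiv.toMonoidHom.comp ((CycEnvelope.algSection R.augY R.chi).comp ι₁)
  have hf₀e : ∀ t, e (f₀ t) = CycEnvelope.algSection R.augY R.chi (ι₁ t) := fun t => e.apply_symm_apply _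
  have hf₀proj : ∀ t, (F.reconstruction e).projY (f₀ t) = ι₁ t := fun t => by
    rw [hprojY, hf₀e]; rfl
  have hf₀top : ∀ t, f₀ t ∈ T.envAtTheta.top := fun t => by
    rw [htop, hf₀proj]; exact t.2
  let f₁ : ↥R.lDeltaTheta →* ↥T.envAtTheta.top := f₀.codRestrict _ hf₀top
  let Sg : ↥R.lDeltaTheta →* T.envAtTheta.carrier :=
    (QuotientGroup.mk' (T.envAtTheta.bot.subgroupOf T.envAtTheta.top)).comp f₁
  have hSg_one : ∀ t : ↥R.lDeltaTheta, Mt.toTheta ((t : ↥C.Huu) : Mt.PiTemp) = 1 → Sg t = 1 := by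
    intro t ht
    change (QuotientGroup.mk (f₁ t) : T.envAtTheta.carrier) = 1
    rw [QuotientGroup.eq_one_iff, Subgroup.mem_subgroupOf]
    change f₀ t ∈ T.envAtTheta.bot
    rw [hbot, hf₀e]
    exact Subgroup.mem_map_of_mem _ (Subgroup.mem_subgroupOf.2 ((hmemK _).2 ht))
  have hSg_eq : ∀ t t' : ↥R.lDeltaTheta,
      Mt.toTheta ((t : ↥C.Huu) : Mt.PiTemp) = Mt.toTheta ((t' : ↥C.Huu) : Mt.PiTemp) → Sg t = Sg t' := by
    intro t t' h
    have h1 : Sg (t⁻¹ * t') = 1 := hSg_one _ (by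
      change Mt.toTheta (((t : ↥C.Huu) : Mt.PiTemp)⁻¹ * ((t' : ↥C.Huu) : Mt.PiTemp)) = 1
      rw [map_mul, map_inv, h, inv_mul_cancel])
    calc Sg t = Sg t * Sg (t⁻¹ * t') := by rw [h1, mul_one]
      _ = Sg t' := by rw [← map_mul, mul_inv_cancel_left]
  have hSg_mul : ∀ t t₁ t₂ : ↥R.lDeltaTheta, Mt.toTheta ((t : ↥C.Huu) : Mt.PiTemp) =
      Mt.toTheta ((t₁ : ↥C.Huu) : Mt.PiTemp) * Mt.toTheta ((t₂ : ↥C.Huu) : Mt.PiTemp) →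
        Sg t = Sg t₁ * Sg t₂ := fun t t₁ t₂ h => by
    rw [← map_mul]; exact hSg_eq _ _ (by rw [h, ← map_mul]; rfl)
  have hSg_proj : ∀ t : ↥R.lDeltaTheta, T.proj (Sg t) =
      (QuotientGroup.mk (⟨ι₁ t, t.2⟩ : ↥(F.reconstruction e).intCyc.top) :
        (F.reconstruction e).intCyc.carrier) := by
    intro t; change T.proj (QuotientGroup.mk (f₁ t)) = _
    rw [ThetaQuotientData.proj, QuotientGroup.map_mk]; congr 1; exact Subtype.ext (hf₀proj t)
  let ι₂ : ↥R.lDeltaTheta →* ↥R.PiYdd := Subgroup.inclusion hlDT_PiYdd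
  let g₀ : ↥R.lDeltaTheta →* Menv.Pi :=
    e.symm.toMulEquiv.toMonoidHom.comp ((R.toThetaEnvData.sTheta hη).comp ι₂)
  have hg₀e : ∀ t, e (g₀ t) = R.toThetaEnvData.sTheta hη (ι₂ t) := fun t => e.apply_symm_apply _
  have hg₀proj : ∀ t, (F.reconstruction e).projY (g₀ t) = ι₁ t := fun t => by
    rw [hprojY, hg₀e]; rfl
  have hg₀top : ∀ t, g₀ t ∈ T.envAtTheta.top := fun t => by
    rw [htop, hg₀proj]; exact t.2
  let g₁ : ↥R.lDeltaTheta →* ↥T.envAtTheta.top := g₀.codRestrict _ hg₀top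
  let SgΘ : ↥R.lDeltaTheta →* T.envAtTheta.carrier :=
    (QuotientGroup.mk' (T.envAtTheta.bot.subgroupOf T.envAtTheta.top)).comp g₁
  have hSgΘ_one : ∀ t : ↥R.lDeltaTheta, Mt.toTheta ((t : ↥C.Huu) : Mt.PiTemp) = 1 → SgΘ t = 1 := by
    intro t ht
    change (QuotientGroup.mk (g₁ t) : T.envAtTheta.carrier) = 1
    rw [QuotientGroup.eq_one_iff, Subgroup.mem_subgroupOf]
    change g₀ t ∈ T.envAtTheta.bot
    rw [hbot, hg₀e, ModelFrame.sTheta_eq_algSection_of_mem_thetaKer hη (ι₂ t) ((hmemK _).2 ht)]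
    exact Subgroup.mem_map_of_mem _ (Subgroup.mem_subgroupOf.2 ((hmemK _).2 ht))
  have hSgΘ_eq : ∀ t t' : ↥R.lDeltaTheta,
      Mt.toTheta ((t : ↥C.Huu) : Mt.PiTemp) = Mt.toTheta ((t' : ↥C.Huu) : Mt.PiTemp) →
        SgΘ t = SgΘ t' := by
    intro t t' h
    have h1 : SgΘ (t⁻¹ * t') = 1 := hSgΘ_one _ (by
      change Mt.toTheta (((t : ↥C.Huu) : Mt.PiTemp)⁻¹ * ((t' : ↥C.Huu) : Mt.PiTemp)) = 1
      rw [map_mul, map_inv, h, inv_mul_cancel])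
    calc SgΘ t = SgΘ t * SgΘ (t⁻¹ * t') := by rw [h1, mul_one]
      _ = SgΘ t' := by rw [← map_mul, mul_inv_cancel_left]
  have hSgΘ_proj : ∀ t : ↥R.lDeltaTheta, T.proj (SgΘ t) =
      (QuotientGroup.mk (⟨ι₁ t, t.2⟩ : ↥(F.reconstruction e).intCyc.top) :
        (F.reconstruction e).intCyc.carrier) := by
    intro t; change T.proj (QuotientGroup.mk (g₁ t)) = _
    rw [ThetaQuotientData.proj, QuotientGroup.map_mk]; congr 1; exact Subtype.ext (hg₀proj t)
  have hmk_eq : ∀ t t' : ↥R.lDeltaTheta,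
      (QuotientGroup.mk (⟨ι₁ t, t.2⟩ : ↥(F.reconstruction e).intCyc.top) :
        (F.reconstruction e).intCyc.carrier) =
      QuotientGroup.mk (⟨ι₁ t', t'.2⟩ : ↥(F.reconstruction e).intCyc.top) →
      Mt.toTheta ((t : ↥C.Huu) : Mt.PiTemp) = Mt.toTheta ((t' : ↥C.Huu) : Mt.PiTemp) := by
    intro t t' h
    rw [QuotientGroup.eq, Subgroup.mem_subgroupOf] at h
    have h' : ((t : ↥C.Huu)⁻¹ * (t' : ↥C.Huu)) ∈ R.thetaKer := h
    rw [hmemK] at h'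
    change Mt.toTheta (((t : ↥C.Huu) : Mt.PiTemp)⁻¹ * ((t' : ↥C.Huu) : Mt.PiTemp)) = 1 at h'
    rwa [map_mul, map_inv, inv_mul_eq_one] at h'
  have hxrep : ∀ a : (F.reconstruction e).lZ, ∃ x : ↥C.Huu,
      (QuotientGroup.mk x : ↥C.Huu ⧸ (F.reconstruction e).inclY.range) = a ∧
        Mt.aug (x : Mt.PiTemp) = 1 := by
    intro a
    obtain ⟨x₀, rfl⟩ := QuotientGroup.mk_surjective a
    obtain ⟨y, hy⟩ := ModelCyclotomes.augY_surjective R (R.aug x₀)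
    refine ⟨x₀ * (y : ↥C.Huu)⁻¹, ?_, ?_⟩
    · refine (QuotientGroup.eq.2 ?_).symm
      rw [← mul_assoc, inv_mul_cancel, one_mul]; exact inv_mem ⟨y, rfl⟩
    · rw [← haugR, MonoidHom.mem_ker, map_mul, map_inv, mul_inv_eq_one]; exact hy.symm
  choose xrep hxrep_mk hxrep_aug using hxrep
  have hyrep : ∀ y : W.DeltaYell, ∃ b : ↥(F.reconstruction e).DeltaY,
      (QuotientGroup.mk b : W.DeltaYell) = y := fun y => QuotientGroup.mk_surjective y
  choose yrep hyrep_mk using hyrep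
  have hcm_mem : ∀ (x : ↥C.Huu), Mt.aug (x : Mt.PiTemp) = 1 →
      ∀ b : ↥(Mt.GtpY.subgroupOf C.Huu), Mt.aug ((b : ↥C.Huu) : Mt.PiTemp) = 1 →
        x * (b : ↥C.Huu) * x⁻¹ * (b : ↥C.Huu)⁻¹ ∈ R.lDeltaTheta := by
    intro x hx b hb
    refine (hcomm _).2 ⟨x, (haugR x).2 hx, (b : ↥C.Huu), ⟨b.2, (haugR _).2 hb⟩, 1, one_mem _, ?_⟩
    rw [mul_one]
  let cmR : (F.reconstruction e).lZ → W.DeltaYell → ↥R.lDeltaTheta := fun a y =>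
    ⟨xrep a * ((yrep y : ↥(Mt.GtpY.subgroupOf C.Huu)) : ↥C.Huu) * (xrep a)⁻¹ *
        (((yrep y : ↥(Mt.GtpY.subgroupOf C.Huu)) : ↥C.Huu))⁻¹,
      hcm_mem (xrep a) (hxrep_aug a) _ (hΔY (yrep y))⟩
  have θcm : ∀ x b : ↥C.Huu, Mt.toTheta (((x * b * x⁻¹ * b⁻¹ : ↥C.Huu)) : Mt.PiTemp) =
      Mt.toTheta (x : Mt.PiTemp) * Mt.toTheta (b : Mt.PiTemp) * (Mt.toTheta (x : Mt.PiTemp))⁻¹ *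
        (Mt.toTheta (b : Mt.PiTemp))⁻¹ := fun x b => by
    simp only [Subgroup.coe_mul, Subgroup.coe_inv, map_mul, map_inv]
  have hcmΔΘ : ∀ (x : ↥C.Huu), Mt.aug (x : Mt.PiTemp) = 1 →
      ∀ b : ↥(Mt.GtpY.subgroupOf C.Huu), Mt.aug ((b : ↥C.Huu) : Mt.PiTemp) = 1 →
        Mt.toTheta (x : Mt.PiTemp) * Mt.toTheta ((b : ↥C.Huu) : Mt.PiTemp) *
          (Mt.toTheta (x : Mt.PiTemp))⁻¹ * (Mt.toTheta ((b : ↥C.Huu) : Mt.PiTemp))⁻¹ ∈ Mt.DeltaTheta := by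
    intro x hx b hb; rw [← θcm]
    exact Mt.toThetaSetting.lDeltaTheta_le l ((hmemL _).1 (hcm_mem x hx b hb))
  have hrepX : ∀ (x x' : ↥C.Huu), Mt.aug (x : Mt.PiTemp) = 1 → Mt.aug (x' : Mt.PiTemp) = 1 →
      (QuotientGroup.mk x : ↥C.Huu ⧸ (F.reconstruction e).inclY.range) = QuotientGroup.mk x' →
      ∀ b : ↥(Mt.GtpY.subgroupOf C.Huu), Mt.aug ((b : ↥C.Huu) : Mt.PiTemp) = 1 →
        Mt.toTheta (((x * b * x⁻¹ * (b : ↥C.Huu)⁻¹ : ↥C.Huu)) : Mt.PiTemp) =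
          Mt.toTheta (((x' * b * x'⁻¹ * (b : ↥C.Huu)⁻¹ : ↥C.Huu)) : Mt.PiTemp) := by
    intro x x' hx hx' hxx' b hb
    rw [QuotientGroup.eq] at hxx'
    obtain ⟨δ, hδ⟩ := hxx'
    have hδY : ((δ : ↥C.Huu) : Mt.PiTemp) ∈ Mt.GtpY := Subgroup.mem_subgroupOf.1 δ.2
    have hδ' : (δ : ↥C.Huu) = x⁻¹ * x' := hδ
    have hx'eq : x' = x * (δ : ↥C.Huu) := by rw [hδ', mul_inv_cancel_left]
    have hδaug : Mt.aug ((δ : ↥C.Huu) : Mt.PiTemp) = 1 := by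
      rw [hδ', Subgroup.coe_mul, Subgroup.coe_inv, map_mul, map_inv, hx, hx', inv_one, one_mul]
    have hδΘ : Mt.toTheta ((δ : ↥C.Huu) : Mt.PiTemp) ∈ Mt.DtpYTheta := Subgroup.mem_map_of_mem _ ⟨hδY, hδaug⟩
    rw [hx'eq, θcm, θcm, Subgroup.coe_mul, map_mul]
    exact (conjComm_central_mul_left _ _ _ (hYab _ hδΘ _ (hθY b hb))).symm
  have hrepY : ∀ (x : ↥C.Huu), Mt.aug (x : Mt.PiTemp) = 1 →
      ∀ b b' : ↥(F.reconstruction e).DeltaY, (QuotientGroup.mk b : W.DeltaYell) = QuotientGroup.mk b' →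
        Mt.toTheta (((x * ((b : ↥(Mt.GtpY.subgroupOf C.Huu)) : ↥C.Huu) * x⁻¹ *
            (((b : ↥(Mt.GtpY.subgroupOf C.Huu)) : ↥C.Huu))⁻¹ : ↥C.Huu)) : Mt.PiTemp) =
          Mt.toTheta (((x * ((b' : ↥(Mt.GtpY.subgroupOf C.Huu)) : ↥C.Huu) * x⁻¹ *
            (((b' : ↥(Mt.GtpY.subgroupOf C.Huu)) : ↥C.Huu))⁻¹ : ↥C.Huu)) : Mt.PiTemp) := by
    intro x hx b b' hbb'
    rw [QuotientGroup.eq, Subgroup.mem_subgroupOf, hWker, Subgroup.mem_comap, MonoidHom.mem_ker] at hbb'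
    have hc : Mt.toTheta ((((b : ↥(Mt.GtpY.subgroupOf C.Huu)) : ↥C.Huu) : Mt.PiTemp)⁻¹ *
        (((b' : ↥(Mt.GtpY.subgroupOf C.Huu)) : ↥C.Huu) : Mt.PiTemp)) ∈ Mt.DeltaTheta := by
      change Mt.thetaToEll _ = 1; exact hbb'
    set β := Mt.toTheta ((((b : ↥(Mt.GtpY.subgroupOf C.Huu)) : ↥C.Huu) : Mt.PiTemp)) with hβ
    set β' := Mt.toTheta ((((b' : ↥(Mt.GtpY.subgroupOf C.Huu)) : ↥C.Huu) : Mt.PiTemp)) with hβ'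
    have hβ'eq : β' = β * (β⁻¹ * β') := by rw [mul_inv_cancel_left]
    rw [θcm, θcm, ← hβ, ← hβ', hβ'eq]
    refine (conjComm_mul_central_right _ _ _ ?_).symm
    rw [map_mul, map_inv] at hc; exact hcent _ hc _ (inv_mem (hθΔ x hx))
  have hle : Subgroup.closure
      (Set.range fun q : (F.reconstruction e).lZ × W.DeltaYell => Sg (cmR q.1 q.2)) ≤ Sg.range := by
    rw [Subgroup.closure_le]; rintro _ ⟨q, rfl⟩; exact ⟨cmR q.1 q.2, rfl⟩
  have hbijΘ : Set.BijOn T.proj (SgΘ.range : Subgroup T.envAtTheta.carrier) Set.univ := by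
    refine ⟨fun _ _ => Set.mem_univ _, ?_, ?_⟩
    · rintro _ ⟨t₁, rfl⟩ _ ⟨t₂, rfl⟩ h
      rw [hSgΘ_proj, hSgΘ_proj] at h; exact hSgΘ_eq _ _ (hmk_eq _ _ h)
    · intro c _
      obtain ⟨g, rfl⟩ := QuotientGroup.mk_surjective c
      exact ⟨SgΘ ⟨((g : ↥R.PiY) : ↥C.Huu), g.2⟩, ⟨_, rfl⟩, by rw [hSgΘ_proj]; rfl⟩
  have hbijA : Set.BijOn T.proj (Subgroup.closure
      (Set.range fun q : (F.reconstruction e).lZ × W.DeltaYell => Sg (cmR q.1 q.2))) Set.univ := by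
    refine ⟨fun _ _ => Set.mem_univ _, ?_, ?_⟩
    · intro s₁ hs₁ s₂ hs₂ h
      obtain ⟨t₁, rfl⟩ := hle hs₁; obtain ⟨t₂, rfl⟩ := hle hs₂
      rw [hSg_proj, hSg_proj] at h; exact hSg_eq _ _ (hmk_eq _ _ h)
    · intro c _
      obtain ⟨g, rfl⟩ := QuotientGroup.mk_surjective c
      obtain ⟨z, hz, b, hb, k, hk, hg⟩ := (hcomm ((g : ↥R.PiY) : ↥C.Huu)).1 g.2
      have hzaug : Mt.aug (z : Mt.PiTemp) = 1 := (haugR z).1 hz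
      have hbaug : Mt.aug (b : Mt.PiTemp) = 1 := (haugR b).1 hb.2
      let bY : ↥(Mt.GtpY.subgroupOf C.Huu) := ⟨b, hb.1⟩
      have hbY : bY ∈ (F.reconstruction e).DeltaY :=
        (mem_deltaY_reconstruction_iff C μ hC hS h15 L F e bY).2 hbaug
      let a : (F.reconstruction e).lZ := (QuotientGroup.mk z : ↥C.Huu ⧸ (F.reconstruction e).inclY.range)
      let y : W.DeltaYell := QuotientGroup.mk ⟨bY, hbY⟩
      refine ⟨Sg (cmR a y), Subgroup.subset_closure ⟨(a, y), rfl⟩, ?_⟩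
      rw [hSg_proj]; apply QuotientGroup.eq.2; rw [Subgroup.mem_subgroupOf]
      change ((cmR a y : ↥R.lDeltaTheta) : ↥C.Huu)⁻¹ * ((g : ↥R.PiY) : ↥C.Huu) ∈ R.thetaKer
      rw [hmemK, Subgroup.coe_mul, Subgroup.coe_inv, map_mul, map_inv, inv_mul_eq_one]
      have h1 := hrepX (xrep a) z (hxrep_aug a) hzaug (hxrep_mk a) _ (hΔY (yrep y))
      have h2 := hrepY z hzaug (yrep y) ⟨bY, hbY⟩ (hyrep_mk y)
      change Mt.toTheta (((xrep a * ((yrep y : ↥(Mt.GtpY.subgroupOf C.Huu)) : ↥C.Huu) * (xrep a)⁻¹ *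
          (((yrep y : ↥(Mt.GtpY.subgroupOf C.Huu)) : ↥C.Huu))⁻¹ : ↥C.Huu)) : Mt.PiTemp) = _
      have hk1 : Mt.toTheta (k : Mt.PiTemp) = 1 := (hmemK k).1 hk
      have hg' : Mt.toTheta (((g : ↥R.PiY) : ↥C.Huu) : Mt.PiTemp) =
          Mt.toTheta (z : Mt.PiTemp) * Mt.toTheta (b : Mt.PiTemp) * (Mt.toTheta (z : Mt.PiTemp))⁻¹ *
            (Mt.toTheta (b : Mt.PiTemp))⁻¹ := by
        rw [hg]; change Mt.toTheta ((z : Mt.PiTemp) * b * (z : Mt.PiTemp)⁻¹ * (b : Mt.PiTemp)⁻¹ * k) = _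
        rw [map_mul, map_mul, map_mul, map_mul, map_inv, map_inv, hk1, mul_one]
      rw [h1, h2, θcm, hg']
  obtain ⟨ψ⟩ := (F.reconstruction e).ext_iso_ZMod
  have hcommExt : ∀ m m' : ↥(F.reconstruction e).extCyc, m * m' = m' * m := fun m m' =>
    ψ.injective (by rw [map_mul, map_mul, mul_comm])
  let invE : ↥(F.reconstruction e).extCyc ≃* ↥(F.reconstruction e).extCyc :=
    { toFun := fun m => m⁻¹, invFun := fun m => m⁻¹, left_inv := fun m => inv_inv m, right_inv := fun m => inv_inv m
      map_mul' := fun m m' => by rw [mul_inv_rev, hcommExt] }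
  let C' : CyclotomicRigidity (F.reconstruction e) :=
    { iso := (F.cyclotomicRigidity e).iso.trans invE
      equivariant := fun x c => by
        change ((F.cyclotomicRigidity e).iso _)⁻¹ =
          (F.reconstruction e).extAct x (((F.cyclotomicRigidity e).iso _)⁻¹)
        rw [(F.cyclotomicRigidity e).equivariant, map_inv] }
  have hmtop : ∀ m : ↥(F.reconstruction e).extCyc, ((m : Menv.Pi))⁻¹ ∈ T.envAtTheta.top := fun m => by
    rw [htop, map_inv, (MonoidHom.mem_ker).1 m.2, inv_one, OneMemClass.coe_one]
    exact one_mem _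
  have hkey : ∀ t : ↥R.lDeltaTheta,
      (QuotientGroup.mk (⟨(((F.cyclotomicRigidity e).iso
          (QuotientGroup.mk (QuotientGroup.mk (⟨ι₁ t, t.2⟩ : ↥(F.reconstruction e).intCyc.top) :
            (F.reconstruction e).intCyc.carrier)) : ↥(F.reconstruction e).extCyc) : Menv.Pi)⁻¹, hmtop _⟩ :
          ↥T.envAtTheta.top) : T.envAtTheta.carrier) = SgΘ t * (Sg t)⁻¹ := by
    intro t
    change _ = (QuotientGroup.mk (g₁ t) : T.envAtTheta.carrier) * (QuotientGroup.mk (f₁ t) : T.envAtTheta.carrier)⁻¹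
    rw [← QuotientGroup.mk_inv, ← QuotientGroup.mk_mul]
    congr 1; apply Subtype.ext; change _ = g₀ t * (f₀ t)⁻¹
    exact (sTheta_mul_sAlg_inv_eq_iso_inv F e hη t).symm
  have hover : ∀ (a : (F.reconstruction e).intCyc.carrier) (t₁ t₂ : ↥R.lDeltaTheta),
      T.proj (SgΘ t₁) = a → T.proj (Sg t₂) = a →
        a = QuotientGroup.mk (⟨ι₁ t₁, t₁.2⟩ : ↥(F.reconstruction e).intCyc.top) ∧ Sg t₂ = Sg t₁ := by
    intro a t₁ t₂ h₁ h₂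
    refine ⟨h₁.symm.trans (hSgΘ_proj t₁), hSg_eq _ _ (hmk_eq _ _ ?_)⟩
    rw [← hSg_proj, h₂, ← hSgΘ_proj, h₁]
  have hmulL : ∀ (a a' : (F.reconstruction e).lZ) (y : W.DeltaYell),
      Sg (cmR (a * a') y) = Sg (cmR a y) * Sg (cmR a' y) := by
    intro a a' y
    apply hSg_mul
    have haa' : Mt.aug ((xrep a * xrep a' : ↥C.Huu) : Mt.PiTemp) = 1 := by
      rw [Subgroup.coe_mul, map_mul, hxrep_aug, hxrep_aug, mul_one]
    have hmk : (QuotientGroup.mk (xrep (a * a')) : ↥C.Huu ⧸ (F.reconstruction e).inclY.range) =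
        QuotientGroup.mk (xrep a * xrep a') := by
      rw [QuotientGroup.mk_mul, hxrep_mk, hxrep_mk, hxrep_mk]; rfl
    rw [hrepX (xrep (a * a')) (xrep a * xrep a') (hxrep_aug _) haa' hmk _ (hΔY (yrep y)), θcm,
      θcm (xrep a) (((yrep y : ↥(F.reconstruction e).DeltaY) : ↥(Mt.GtpY.subgroupOf C.Huu)) : ↥C.Huu),
      θcm (xrep a') (((yrep y : ↥(F.reconstruction e).DeltaY) : ↥(Mt.GtpY.subgroupOf C.Huu)) : ↥C.Huu),
      Subgroup.coe_mul, map_mul]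
    refine conjComm_mul_left _ _ _ ?_ ?_
    · exact (hcent _ (hcmΔΘ (xrep a') (hxrep_aug a') _ (hΔY (yrep y))) _ (hθΔ _ (hxrep_aug a))).symm
    · exact hcommΘ _ (hcmΔΘ (xrep a) (hxrep_aug a) _ (hΔY (yrep y))) _
        (hcmΔΘ (xrep a') (hxrep_aug a') _ (hΔY (yrep y)))
  have hmulR : ∀ (a : (F.reconstruction e).lZ) (y y' : W.DeltaYell),
      Sg (cmR a (y * y')) = Sg (cmR a y) * Sg (cmR a y') := by
    intro a y y'
    apply hSg_mul
    have hmk : (QuotientGroup.mk (yrep (y * y')) : W.DeltaYell) = QuotientGroup.mk (yrep y * yrep y') := by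
      rw [QuotientGroup.mk_mul, hyrep_mk, hyrep_mk, hyrep_mk]
    rw [hrepY (xrep a) (hxrep_aug a) (yrep (y * y')) (yrep y * yrep y') hmk, θcm,
      θcm (xrep a) (((yrep y : ↥(F.reconstruction e).DeltaY) : ↥(Mt.GtpY.subgroupOf C.Huu)) : ↥C.Huu),
      θcm (xrep a) (((yrep y' : ↥(F.reconstruction e).DeltaY) : ↥(Mt.GtpY.subgroupOf C.Huu)) : ↥C.Huu)]
    have e3 : ((((yrep y * yrep y' : ↥(F.reconstruction e).DeltaY) : ↥(Mt.GtpY.subgroupOf C.Huu)) :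
        ↥C.Huu) : Mt.PiTemp) =
        (((yrep y : ↥(Mt.GtpY.subgroupOf C.Huu)) : ↥C.Huu) : Mt.PiTemp) *
          (((yrep y' : ↥(Mt.GtpY.subgroupOf C.Huu)) : ↥C.Huu) : Mt.PiTemp) := rfl
    rw [e3, map_mul]
    refine conjComm_mul_right _ _ _ ?_
    exact (hcent _ (hcmΔΘ (xrep a) (hxrep_aug a) _ (hΔY (yrep y'))) _
      (hYΔ (hθY _ (hΔY (yrep y))))).symm
  let Sec : TwoSections T W :=
    { sTheta := SgΘ.range
      sAlg := Subgroup.closure (Set.range fun q : (F.reconstruction e).lZ × W.DeltaYell => Sg (cmR q.1 q.2))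
      sTheta_bijOn := hbijΘ, sAlg_bijOn := hbijA, extCyc_inf_bot := hText, commutator := fun a y => Sg (cmR a y)
      commutator_mul_left := hmulL, commutator_mul_right := hmulR
      lZ_iso := ModelFrame.nonempty_lZ_mulEquiv_int F e
      sAlg_eq_closure := rfl }
  have hSecΘ : Sec.sTheta = SgΘ.range := rfl
  have hSecA : Sec.sAlg =
      Subgroup.closure (Set.range fun q : (F.reconstruction e).lZ × W.DeltaYell => Sg (cmR q.1 q.2)) := rfl
  have hdiffC' : rigidity_is_difference Sec C' := by
    intro a t s ht hs hta hsa
    rw [hSecΘ] at ht; rw [hSecA] at hs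
    obtain ⟨t₁, rfl⟩ := ht; obtain ⟨t₂, rfl⟩ := hle hs
    obtain ⟨ha, h21⟩ := hover a t₁ t₂ hta hsa
    subst ha; rw [h21]; exact ⟨C'.iso _, rfl, hkey t₁⟩
  refine ⟨T, Sec, C', hTsec, fun c => rfl, hdiffC', fun g => ⟨hg₀top g, ?_⟩, fun s hs => ?_, fun x hx b => ?_⟩
  · rw [hSecΘ]; exact ⟨g, rfl⟩
  · rw [hSecA] at hs; obtain ⟨t, rfl⟩ := hle hs; exact ⟨t, hf₀top t, rfl⟩
  · -- (P3): the commutator map does not depend on the lifts ((T1)/(T2))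
    refine ⟨hcm_mem x hx _ (hΔY b), hf₀top ⟨_, hcm_mem x hx _ (hΔY b)⟩, ?_⟩
    change Sg (cmR (QuotientGroup.mk x) (QuotientGroup.mk b)) = Sg ⟨_, hcm_mem x hx _ (hΔY b)⟩
    apply hSg_eq
    exact (hrepX (xrep _) x (hxrep_aug _) hx (hxrep_mk _) _ (hΔY (yrep _))).trans
      (hrepY x hx (yrep _) b (hyrep_mk _))

end ModelFrame
end Literature.IUT.HodgeArakelov
end
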